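import Literature.MathematicalPhysics.KineticTheory.VelocityFlipSteadyStateExists
import Literature.MathematicalPhysics.KineticTheory.LangevinSemigroupProofs
import Literature.Probability.Process.InvariantUniqueness
import HarnessLib

/-!
# The embedded flip chain of the pinned chain with velocity flips; uniqueness of its invariant law

Trunk T-KINETIC (Literature/MathematicalPhysics/KineticTheory). The velocity-flip model of
Bernardin–Olla (generator `L + ε S`, `S f = ∑_i (f ∘ momentumFlip i - f)`, `VelocityFlipNoise.lean`)
runs the flip-free Langevin dynamics `P_t` (a `LangevinChainSemigroup`) between the events of a
rate-`Nε` Poisson clock and flips a uniformly chosen momentum at each event. This file names the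
kernels of the chain EMBEDDED AT THE FLIP TIMES and proves that, for the pinned anharmonic chain,
it has AT MOST ONE invariant probability measure:

* `LangevinChainSemigroup.timeKernel S` — the time-extended kernel `(t, z) ↦ P_{t⁺}(z, ·)`;
  `LangevinChainSemigroup.resolventKernel S r = timeKernel ∘ₖ (const Exp_r ×ₖ id)` — the
  **resolvent kernel** `R_r(z, ·) = ∫₀^∞ r e^{-rt} P_t(z, ·) dt` (the flip-free chain observed at an
  independent exponential time of rate `r`; the def-free composite of `LangevinChainResolvent.lean`,
  now named), a Markov kernel for `r > 0`;
* `flipKernel N` — the uniform single-site momentum flip `Q(z, ·) = N⁻¹ ∑_i δ_{z^i}` (`N ≥ 1`;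
  for `N = 0` the junk value `Kernel.id`), a Markov kernel;
* `LangevinChainSemigroup.embeddedFlipKernel S r = flipKernel N ∘ₖ resolventKernel S r` — one
  step `K = Q R_r` of the embedded chain (first `R_r`, then `Q`).

Why invariant laws of `K` matter: if `π K = π` then `μ := π R` satisfies, for `f ∈ C_c^∞` and
`r = Nε`, `∫ Lf dμ = π(R L f) = Nε (μ f - π f)` (resolvent identity) and
`ε ∫ Sf dμ = Nε (μ(Qf) - μ f) = Nε (π f - μ f)` (`μ Q = π R Q = π K = π`), which cancel: `μ` is a
weak flip steady state (`exists_isFlipSteadyState_of_resolventKernel`,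
`VelocityFlipSteadyStateExists.lean`; the named-kernel form, the resolvent identity, the Feller
and Lyapunov properties of `R_r` and the existence of a `K`-invariant law with an exponential
moment are in the companion file `VelocityFlipEmbeddedChainSteadyState.lean`). Uniqueness of the
weak flip steady state thus splits into (U1) every weak flip steady state is `π R_{Nε}` for a
`K`-invariant probability measure `π` (a weak Fokker–Planck identification, NOT in the tree) and
(U2) `K` has at most one invariant probability measure — proved here:

* `LangevinChainSemigroup.exists_le_resolventKernel_of_le_kernel` — a single-time minorisation
  `P_{t_C}(z, ·) ≥ ν` on `C` gives `R_r(z, ·) ≥ m` on `C` with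
  `m = ∫_{t > t_C} ν P_{t - t_C} Exp_r(dt) ≠ 0` (Chapman–Kolmogorov, monotonicity of `μ ↦ μ P`);
* `pinnedChain_resolventKernel_minorization` — by CEHR Prop. 3.6 (`pinnedChain_minorization`)
  every compact set is small for `R_r` of the pinned chain;
  `pinnedChain_embeddedFlipKernel_minorization` — the flip transports it to `K` (`m ↦ m Q`, same
  mass);
* `pinnedChain_embeddedFlipKernel_invariant_unique` — **two `K`-invariant probability measures
  coincide** (`invariant_unique_of_small_cover`, the Doeblin small-set argument, with the compact
  energy sublevel sets `{H ≤ n}` exhausting phase space).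

NOT here: (U1); the flip semigroup `e^{t(L + εS)}`; rates of convergence.

## References

* C. Bernardin, S. Olla, *Transport properties of a chain of anharmonic oscillators with random
  flip of velocities*, J. Stat. Phys. 145 (2011) 1224–1255, §2.1 and Prop. 1.
* N. Cuneo, J.-P. Eckmann, M. Hairer, L. Rey-Bellet, *Non-equilibrium steady states for networks of
  oscillators*, Electron. J. Probab. 23 (2018) no. 55, Props. 3.6, 3.8.
* S. P. Meyn, R. L. Tweedie, *Markov Chains and Stochastic Stability* (1993), Ch. 5 (small sets),
  Thm 10.0.1; S. N. Ethier, T. G. Kurtz, *Markov Processes* (1986), Ch. 1 §2, Ch. 4 §10.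
-/

noncomputable section

open MeasureTheory ProbabilityTheory Filter Topology Set
open scoped NNReal ENNReal ContDiff BoundedContinuousFunction

namespace Literature.MathematicalPhysics.KineticTheory.HeatConduction

open Literature.Probability.Process OscillatorChain

/-! ### Time averages: setwise form; the exponential law charges every right half-line -/

section Averaging

variable {X Y : Type*} [MeasurableSpace X] [MeasurableSpace Y]

/-- Setwise form of the time average of a kernel:
`(K ∘ₖ (const ρ ×ₖ id))(z, A) = ∫ K((t, z), A) ρ(dt)`. [folklore] -/
theorem comp_const_prod_id_apply (K : Kernel (ℝ × X) Y) [IsSFiniteKernel K] (ρ : Measure ℝ)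
    [SFinite ρ] (z : X) {A : Set Y} (hA : MeasurableSet A) :
    (K ∘ₖ (Kernel.const X ρ ×ₖ Kernel.id)) z A = ∫⁻ t, K (t, z) A ∂ρ := by
  rw [← lintegral_indicator_one hA,
    lintegral_comp_const_prod_id K ρ z (measurable_one.indicator hA)]
  simp_rw [lintegral_indicator_one hA]

end Averaging

/-- The exponential law of rate `r > 0` charges `(a, ∞)`: `Exp_r(a, ∞) = e^{-ra} ≠ 0` (`a ≥ 0`).
[folklore] -/
theorem expMeasure_Ioi_ne_zero {r : ℝ} (hr : 0 < r) {a : ℝ} (ha : 0 ≤ a) :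
    expMeasure r (Ioi a) ≠ 0 := by
  haveI := isProbabilityMeasure_expMeasure hr
  rw [← compl_Iic, prob_compl_eq_one_sub measurableSet_Iic, ← ofReal_cdf, cdf_expMeasure_eq hr,
    if_pos ha]
  refine (tsub_pos_iff_lt.2 ?_).ne'
  rw [ENNReal.ofReal_lt_one]
  linarith [Real.exp_pos (-(r * a))]

/-! ### The resolvent kernel of a Langevin-chain semigroup, as a named kernel -/

namespace LangevinChainSemigroup

variable {P : OscillatorChain} {N : ℕ} {T_L T_R : ℝ} (S : LangevinChainSemigroup P N T_L T_R)

/-- The **time-extended kernel** `(t, z) ↦ P_{t⁺}(z, ·)` of a Langevin-chain semigroup (negative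
times sent to `P_0 = id`), a Markov kernel on `ℝ × (phase space)` (joint measurability is the field
`measurable_kernel`). [folklore] -/
def timeKernel : Kernel (ℝ × PhaseSpace N) (PhaseSpace N) where
  toFun p := S.kernel p.1.toNNReal p.2
  measurable' := Measurable.comp (g := fun q : ℝ≥0 × PhaseSpace N => S.kernel q.1 q.2)
    (f := fun p : ℝ × PhaseSpace N => (p.1.toNNReal, p.2)) S.measurable_kernel (by fun_prop)

/-- Unfolding `timeKernel`. [folklore] -/
@[simp] theorem timeKernel_apply (t : ℝ) (z : PhaseSpace N) :
    S.timeKernel (t, z) = S.kernel t.toNNReal z := rfl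

/-- The time-extended kernel is Markov. [folklore] -/
instance isMarkovKernel_timeKernel : IsMarkovKernel S.timeKernel :=
  ⟨fun p => by change IsProbabilityMeasure (S.kernel p.1.toNNReal p.2); infer_instance⟩

/-- The **resolvent kernel** at rate `r` of a Langevin-chain semigroup:
`R_r(z, ·) = ∫₀^∞ r e^{-rt} P_t(z, ·) dt`, the law of the chain started at `z` and observed at an
independent `Exp_r`-distributed time (Ethier–Kurtz, Ch. 1 §2: `R_r = r (r - L)⁻¹` as the Laplace
transform of the semigroup), built as the composite `timeKernel ∘ₖ (const Exp_r ×ₖ id)` with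
Mathlib's `expMeasure r`. Meaningful for `r > 0` (for `r ≤ 0` the density `r e^{-rt} 1_{t ≥ 0}` is
nonpositive, `expMeasure r` is the zero measure, and the kernel is a junk value). [folklore] -/
def resolventKernel (r : ℝ) : Kernel (PhaseSpace N) (PhaseSpace N) :=
  S.timeKernel ∘ₖ (Kernel.const (PhaseSpace N) (expMeasure r) ×ₖ Kernel.id)

/-- Unfolding `resolventKernel`. [folklore] -/
theorem resolventKernel_eq (r : ℝ) : S.resolventKernel r =
    S.timeKernel ∘ₖ (Kernel.const (PhaseSpace N) (expMeasure r) ×ₖ Kernel.id) := rfl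

/-- The resolvent kernel at a positive rate is a Markov kernel. [folklore] -/
theorem isMarkovKernel_resolventKernel {r : ℝ} (hr : 0 < r) :
    IsMarkovKernel (S.resolventKernel r) := by
  haveI := isProbabilityMeasure_expMeasure hr
  rw [resolventKernel_eq]; infer_instance

/-- Setwise: `R_r(z, A) = ∫ P_{t⁺}(z, A) Exp_r(dt)`. [folklore] -/
theorem resolventKernel_apply {r : ℝ} (hr : 0 < r) (z : PhaseSpace N) {A : Set (PhaseSpace N)}
    (hA : MeasurableSet A) :
    S.resolventKernel r z A = ∫⁻ t, S.kernel t.toNNReal z A ∂(expMeasure r) := by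
  haveI := isProbabilityMeasure_expMeasure hr
  exact comp_const_prod_id_apply S.timeKernel (expMeasure r) z hA

/-- `∫⁻ V dR_r(z, ·) = ∫ (∫⁻ V dP_{t⁺}(z, ·)) Exp_r(dt)` for measurable `V ≥ 0`. [folklore] -/
theorem lintegral_resolventKernel {r : ℝ} (hr : 0 < r) (z : PhaseSpace N)
    {V : PhaseSpace N → ℝ≥0∞} (hV : Measurable V) :
    ∫⁻ y, V y ∂(S.resolventKernel r z) =
      ∫⁻ t, ∫⁻ y, V y ∂(S.kernel t.toNNReal z) ∂(expMeasure r) := by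
  haveI := isProbabilityMeasure_expMeasure hr
  exact lintegral_comp_const_prod_id S.timeKernel (expMeasure r) z hV

/-- `∫ g dR_r(z, ·) = ∫ (P_{t⁺} g)(z) Exp_r(dt)` for bounded measurable `g`. [folklore] -/
theorem integral_resolventKernel {r : ℝ} (hr : 0 < r) (z : PhaseSpace N) {g : PhaseSpace N → ℝ}
    (hg : StronglyMeasurable g) {C : ℝ} (hC : ∀ y, ‖g y‖ ≤ C) :
    ∫ y, g y ∂(S.resolventKernel r z) = ∫ t, S.act t.toNNReal g z ∂(expMeasure r) := by
  haveI := isProbabilityMeasure_expMeasure hr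
  exact integral_comp_const_prod_id S.timeKernel (expMeasure r) z hg hC

/-- **A single-time minorisation on `C` minorises the resolvent kernel on `C`** (Doeblin): if
`ν ≤ P_{t_C}(z, ·)` for all `z ∈ C` (`ν` finite), then for `t > t_C`,
`P_t(z, ·) = (P_{t_C}(z, ·)) P_{t - t_C} ≥ ν P_{t - t_C}` (Chapman–Kolmogorov, monotonicity of
`μ ↦ μ P`), so `R_r(z, ·) ≥ m := ∫_{t > t_C} ν P_{t - t_C} Exp_r(dt)` on `C`, and
`m(X) = ν(X) Exp_r(t_C, ∞) ≠ 0` when `ν ≠ 0`. [folklore] -/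
theorem exists_le_resolventKernel_of_le_kernel {r : ℝ} (hr : 0 < r) {C : Set (PhaseSpace N)}
    {t_C : ℝ≥0} {ν : Measure (PhaseSpace N)} [IsFiniteMeasure ν] (hν0 : ν ≠ 0)
    (hν : ∀ z ∈ C, ν ≤ S.kernel t_C z) :
    ∃ m : Measure (PhaseSpace N), m ≠ 0 ∧ ∀ z ∈ C, m ≤ S.resolventKernel r z := by
  haveI := isProbabilityMeasure_expMeasure hr
  set ρ := expMeasure r with hρ
  -- the time-shifted kernel `(t, x) ↦ P_{(t - t_C)⁺}(x, ·)` and `F t = ν P_{(t - t_C)⁺}`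
  let K' : Kernel (ℝ × PhaseSpace N) (PhaseSpace N) :=
    ⟨fun p => S.kernel (p.1 - t_C).toNNReal p.2,
      Measurable.comp (g := fun q : ℝ≥0 × PhaseSpace N => S.kernel q.1 q.2)
        (f := fun p : ℝ × PhaseSpace N => ((p.1 - t_C).toNNReal, p.2)) S.measurable_kernel
        (by fun_prop)⟩
  have hK' : ∀ (t : ℝ) (x : PhaseSpace N), K' (t, x) = S.kernel (t - t_C).toNNReal x := fun _ _ => rfl
  let F : ℝ → Measure (PhaseSpace N) := fun t => ν.bind fun x => K' (t, x)
  have hFapply : ∀ (t : ℝ) {A : Set (PhaseSpace N)}, MeasurableSet A →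
      F t A = ∫⁻ x, K' (t, x) A ∂ν := fun t A hA =>
    Measure.bind_apply hA (K'.measurable.comp measurable_prodMk_left).aemeasurable
  have hF : Measurable F := Measure.measurable_of_measurable_coe _ fun A hA => by
    simp_rw [hFapply _ hA]
    exact (K'.measurable_coe hA).lintegral_prod_right'
  refine ⟨(ρ.restrict (Ioi (t_C : ℝ))).bind F, fun h0 => ?_, fun z hz => ?_⟩
  · -- total mass `ν univ * ρ (Ioi t_C) ≠ 0`
    have h1 : ((ρ.restrict (Ioi (t_C : ℝ))).bind F) univ = ν univ * ρ (Ioi (t_C : ℝ)) := by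
      rw [Measure.bind_apply MeasurableSet.univ hF.aemeasurable]
      have h2 : ∀ t, F t univ = ν univ := fun t => by
        rw [hFapply t MeasurableSet.univ]
        simp only [hK', measure_univ, lintegral_const, one_mul]
      simp_rw [h2]
      rw [lintegral_const, Measure.restrict_apply MeasurableSet.univ, univ_inter]
    rw [h0, Measure.coe_zero, Pi.zero_apply] at h1
    rcases mul_eq_zero.1 h1.symm with h3 | h3
    · exact hν0 (Measure.measure_univ_eq_zero.1 h3)
    · exact expMeasure_Ioi_ne_zero hr t_C.coe_nonneg h3
  · refine Measure.le_iff.2 fun A hA => ?_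
    rw [Measure.bind_apply hA hF.aemeasurable, S.resolventKernel_apply hr z hA]
    refine (setLIntegral_mono' measurableSet_Ioi fun t ht => ?_).trans
      (setLIntegral_le_lintegral _ _)
    -- `t = t_C + u`, `P_t(z, ·) = P_{t_C}(z, ·) P_u ≥ ν P_u`
    have ht' : (t_C : ℝ) ≤ t := le_of_lt ht
    have hu : t.toNNReal = t_C + (t - t_C).toNNReal := by
      conv_lhs => rw [← add_sub_cancel (t_C : ℝ) t]
      rw [Real.toNNReal_add t_C.coe_nonneg (sub_nonneg.2 ht'), Real.toNNReal_coe]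
    rw [hFapply t hA, hu, S.kernel_add_apply]
    simp only [hK']
    rw [← Measure.bind_apply hA (Kernel.aemeasurable _)]
    exact Measure.le_iff.1 (bind_le_bind_of_le (hν z hz) _) A hA

end LangevinChainSemigroup

/-! ### The flip kernel and the embedded chain -/

/-- The **uniform single-site momentum flip** `Q(z, ·) = N⁻¹ ∑_i δ_{z^i}` (`z^i = momentumFlip i z`:
the momentum of a uniformly chosen particle is reversed), the jump kernel of the flip noise
`S = N (Q - I)` of Bernardin–Olla; for `N = 0` (no particle to flip) the junk value `Kernel.id`.
[cite: BernardinOlla2011, §2.1] -/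
def flipKernel : (N : ℕ) → Kernel (PhaseSpace N) (PhaseSpace N)
  | 0 => Kernel.id
  | n + 1 =>
    { toFun := fun z =>
        ((n + 1 : ℕ) : ℝ≥0∞)⁻¹ • ∑ i : Fin (n + 1), Measure.dirac (momentumFlip i z)
      measurable' := by
        refine Measure.measurable_of_measurable_coe _ fun s hs => ?_
        simp only [Measure.smul_apply, Measure.finsetSum_apply, Measure.dirac_apply' _ hs,
          smul_eq_mul]
        exact (Finset.measurable_sum _ fun i _ =>
          (measurable_one.indicator hs).comp (measurable_momentumFlip i)).const_mul _ }

section Flip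

variable {N : ℕ}

/-- `Q(z, ·) = N⁻¹ ∑_i δ_{z^i}` for `N ≥ 1`. [folklore] -/
theorem flipKernel_apply (hN : 0 < N) (z : PhaseSpace N) :
    flipKernel N z = (N : ℝ≥0∞)⁻¹ • ∑ i : Fin N, Measure.dirac (momentumFlip i z) := by
  obtain ⟨n, rfl⟩ := Nat.exists_eq_succ_of_ne_zero hN.ne'
  rfl

/-- `∫⁻ W dQ(z, ·) = N⁻¹ ∑_i W(z^i)` (`N ≥ 1`). [folklore] -/
theorem lintegral_flipKernel (hN : 0 < N) (W : PhaseSpace N → ℝ≥0∞) (z : PhaseSpace N) :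
    ∫⁻ y, W y ∂(flipKernel N z) = (N : ℝ≥0∞)⁻¹ * ∑ i : Fin N, W (momentumFlip i z) := by
  rw [flipKernel_apply hN, lintegral_smul_measure, lintegral_finsetSum_measure, smul_eq_mul]
  simp only [lintegral_dirac]

/-- `∫ g dQ(z, ·) = N⁻¹ ∑_i g(z^i)` (`N ≥ 1`). [folklore] -/
theorem integral_flipKernel (hN : 0 < N) (g : PhaseSpace N → ℝ) (z : PhaseSpace N) :
    ∫ y, g y ∂(flipKernel N z) = (N : ℝ)⁻¹ * ∑ i : Fin N, g (momentumFlip i z) := by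
  rw [flipKernel_apply hN, integral_smul_measure,
    integral_finsetSum_measure fun i _ => integrable_dirac enorm_lt_top, smul_eq_mul,
    ENNReal.toReal_inv, ENNReal.toReal_natCast]
  simp only [integral_dirac]

/-- The flip kernel is a Markov kernel. [folklore] -/
instance isMarkovKernel_flipKernel : (N : ℕ) → IsMarkovKernel (flipKernel N)
  | 0 => show IsMarkovKernel Kernel.id from inferInstance
  | n + 1 => by
    refine ⟨fun z => ⟨?_⟩⟩
    rw [← lintegral_one, lintegral_flipKernel n.succ_pos]
    simp only [Finset.sum_const, Finset.card_univ, Fintype.card_fin, nsmul_eq_mul, mul_one]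
    exact ENNReal.inv_mul_cancel (Nat.cast_ne_zero.2 n.succ_ne_zero) (ENNReal.natCast_ne_top _)

/-- `m ↦ m Q` preserves nonzero measures (it preserves total mass). [folklore] -/
theorem bind_flipKernel_ne_zero {m : Measure (PhaseSpace N)} (hm : m ≠ 0) :
    m.bind (flipKernel N) ≠ 0 := fun h => by
  refine hm (Measure.measure_univ_eq_zero.1 ?_)
  rw [← Measure.comp_apply_univ (κ := flipKernel N) (μ := m), h, Measure.coe_zero, Pi.zero_apply]

end Flip

namespace LangevinChainSemigroup

variable {P : OscillatorChain} {N : ℕ} {T_L T_R : ℝ} (S : LangevinChainSemigroup P N T_L T_R)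

/-- **One step of the chain embedded at the flip times**: `K = Q ∘ₖ R_r` — run the flip-free
dynamics for an `Exp_r` time (`resolventKernel`), then flip a uniformly chosen momentum
(`flipKernel`); at `r = Nε` this is the velocity-flip model of Bernardin–Olla observed just
after its flip times. [cite: BernardinOlla2011, §2.1 and Prop. 1] -/
def embeddedFlipKernel (r : ℝ) : Kernel (PhaseSpace N) (PhaseSpace N) :=
  flipKernel N ∘ₖ S.resolventKernel r

/-- Unfolding `embeddedFlipKernel`. [folklore] -/
theorem embeddedFlipKernel_eq (r : ℝ) :
    S.embeddedFlipKernel r = flipKernel N ∘ₖ S.resolventKernel r := rfl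

/-- The embedded flip kernel at a positive rate is Markov. [folklore] -/
theorem isMarkovKernel_embeddedFlipKernel {r : ℝ} (hr : 0 < r) :
    IsMarkovKernel (S.embeddedFlipKernel r) := by
  haveI := S.isMarkovKernel_resolventKernel hr
  rw [embeddedFlipKernel_eq]; infer_instance

/-- **The flip transports minorisations**: `m ≤ R_r(z, ·)` implies `m Q ≤ K(z, ·) = R_r(z, ·) Q`.
[folklore] -/
theorem bind_flipKernel_le_embeddedFlipKernel {r : ℝ} {m : Measure (PhaseSpace N)}
    {z : PhaseSpace N} (h : m ≤ S.resolventKernel r z) :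
    m.bind (flipKernel N) ≤ S.embeddedFlipKernel r z := by
  rw [embeddedFlipKernel_eq, Kernel.comp_apply]
  exact bind_le_bind_of_le h _

end LangevinChainSemigroup

/-! ### The pinned chain: every compact set is small; uniqueness of the invariant law -/

section Pinned

variable {ω₂ lam β γ : ℝ} {N : ℕ} {T_L T_R : ℝ}

/-- **Every compact set is small for the resolvent kernel of the pinned chain**
(`ω₂, β, γ > 0`, `lam ≥ 0`, `N ≥ 1`, `T_L, T_R > 0`, `r > 0`): for compact `C` there is a nonzero
measure `m` with `R_r(z, ·) ≥ m` for all `z ∈ C`. From CEHR Prop. 3.6 (`pinnedChain_minorization`: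
`P_{t_C}(z, ·) ≥ ν ≠ 0` on `C`) and `exists_le_resolventKernel_of_le_kernel`.
[cite: CuneoEckmannHairerReyBellet2018, Prop 3.6] -/
theorem pinnedChain_resolventKernel_minorization (hω : 0 < ω₂) (hl : 0 ≤ lam) (hβ : 0 < β)
    (hγ : 0 < γ) (hN : 0 < N) (hL : 0 < T_L) (hR : 0 < T_R) {r : ℝ} (hr : 0 < r)
    {C : Set (PhaseSpace N)} (hC : IsCompact C) :
    ∃ m : Measure (PhaseSpace N), m ≠ 0 ∧
      ∀ z ∈ C, m ≤ (pinnedChainSemigroup hω hl hβ.le hγ.le hN hL.le hR.le).resolventKernel r z := by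
  obtain ⟨t_C, ht⟩ := pinnedChain_minorization hω hl hβ hγ hN hL hR C hC
  obtain ⟨ν, hν0, hν⟩ := ht t_C le_rfl
  set Sg := pinnedChainSemigroup hω hl hβ.le hγ.le hN hL.le hR.le with hSg
  rcases C.eq_empty_or_nonempty with rfl | ⟨z₀, hz₀⟩
  · exact ⟨Measure.dirac 0, IsProbabilityMeasure.ne_zero _, fun z hz => hz.elim⟩
  · have hν' : ∀ z ∈ C, ν ≤ Sg.kernel t_C z := hν
    have hle : ν univ ≤ Sg.kernel t_C z₀ univ := Measure.le_iff'.1 (hν' z₀ hz₀) univ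
    haveI : IsFiniteMeasure ν := ⟨hle.trans_lt (measure_lt_top _ _)⟩
    exact Sg.exists_le_resolventKernel_of_le_kernel hr hν0 hν'

/-- **Every compact set is small for the embedded flip chain of the pinned chain**: the flip
transports the minorisation of `R_r` (`m ↦ m Q`, same mass).
[cite: CuneoEckmannHairerReyBellet2018, Prop 3.6] -/
theorem pinnedChain_embeddedFlipKernel_minorization (hω : 0 < ω₂) (hl : 0 ≤ lam) (hβ : 0 < β)
    (hγ : 0 < γ) (hN : 0 < N) (hL : 0 < T_L) (hR : 0 < T_R) {r : ℝ} (hr : 0 < r)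
    {C : Set (PhaseSpace N)} (hC : IsCompact C) :
    ∃ m : Measure (PhaseSpace N), m ≠ 0 ∧
      ∀ z ∈ C, m ≤ (pinnedChainSemigroup hω hl hβ.le hγ.le hN hL.le hR.le).embeddedFlipKernel r z := by
  obtain ⟨m, hm0, hm⟩ := pinnedChain_resolventKernel_minorization hω hl hβ hγ hN hL hR hr hC
  exact ⟨m.bind (flipKernel N), bind_flipKernel_ne_zero hm0, fun z hz =>
    LangevinChainSemigroup.bind_flipKernel_le_embeddedFlipKernel _ (hm z hz)⟩

/-- **Uniqueness of the invariant probability measure of the embedded flip chain** (pinned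
anharmonic chain `pinnedChain ω₂ lam β γ`, `ω₂, β, γ > 0`, `lam ≥ 0`, `N ≥ 1`, `T_L, T_R > 0`,
any rate `r > 0`): two probability measures `μ, ν` with `μ K = μ`, `ν K = ν` for
`K = Q ∘ₖ R_r` coincide. Doeblin's small-set argument (`invariant_unique_of_small_cover`): the
compact energy sublevel sets `{H ≤ n}` (`pinnedChain_isCompact_setOf_hamiltonian_le`) increase to
the whole phase space and each is small for `K` (`pinnedChain_embeddedFlipKernel_minorization`).
With (U1) "every weak flip steady state is `π R_{Nε}` for a `K`-invariant `π`" this is the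
uniqueness half of Bernardin–Olla 2011, Prop. 1 ("there exists a unique stationary probability
measure") for the BLR pinned chain with flips at every site. [cite: BernardinOlla2011, Prop. 1] -/
theorem pinnedChain_embeddedFlipKernel_invariant_unique (hω : 0 < ω₂) (hl : 0 ≤ lam) (hβ : 0 < β)
    (hγ : 0 < γ) (hN : 0 < N) (hL : 0 < T_L) (hR : 0 < T_R) {r : ℝ} (hr : 0 < r)
    {μ ν : Measure (PhaseSpace N)} [IsProbabilityMeasure μ] [IsProbabilityMeasure ν]
    (hμ : Kernel.Invariant
      ((pinnedChainSemigroup hω hl hβ.le hγ.le hN hL.le hR.le).embeddedFlipKernel r) μ)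
    (hν : Kernel.Invariant
      ((pinnedChainSemigroup hω hl hβ.le hγ.le hN hL.le hR.le).embeddedFlipKernel r) ν) :
    μ = ν := by
  set K := (pinnedChainSemigroup hω hl hβ.le hγ.le hN hL.le hR.le).embeddedFlipKernel r with hK
  haveI : IsMarkovKernel K :=
    (pinnedChainSemigroup hω hl hβ.le hγ.le hN hL.le hR.le).isMarkovKernel_embeddedFlipKernel hr
  -- the small cover by energy sublevel sets
  set C : ℕ → Set (PhaseSpace N) := fun n => {x | (pinnedChain ω₂ lam β γ).hamiltonian N x ≤ n}
    with hC
  have hCmono : Monotone C := fun m n hmn x hx => by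
    have hx' : (pinnedChain ω₂ lam β γ).hamiltonian N x ≤ m := hx
    show (pinnedChain ω₂ lam β γ).hamiltonian N x ≤ n
    exact hx'.trans (by exact_mod_cast hmn)
  have hCcov : ⋃ n, C n = univ := by
    refine eq_univ_of_forall fun x =>
      mem_iUnion.2 ⟨⌈(pinnedChain ω₂ lam β γ).hamiltonian N x⌉₊, ?_⟩
    show (pinnedChain ω₂ lam β γ).hamiltonian N x ≤
      (⌈(pinnedChain ω₂ lam β γ).hamiltonian N x⌉₊ : ℕ)
    exact Nat.le_ceil _
  have hsmall : ∀ n, ∃ _i : Unit, ∃ m : Measure (PhaseSpace N), m ≠ 0 ∧ ∀ x ∈ C n, m ≤ K x :=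
    fun n => ⟨(), pinnedChain_embeddedFlipKernel_minorization hω hl hβ hγ hN hL hR hr
      (pinnedChain_isCompact_setOf_hamiltonian_le hω hl hβ.le γ N n)⟩
  exact invariant_unique_of_small_cover (fun _ : Unit => K) C hCmono hCcov hsmall (fun _ => hμ)
    (fun _ => hν)

end Pinned

end Literature.MathematicalPhysics.KineticTheory.HeatConduction
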